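import Summits.BirchSwinnertonDyer.Rank1Residual.Additive.KatoDescentKatoRigidTwistedValues
import Literature.NumberTheory.EllipticCurves.KatoTwistedFinitenessEulerFactorsProofs
import HarnessLib

set_option autoImplicit false

/-!
# AUG engine, step 4: the two depletions `p·A₁`, `p·A₂` of the value law read through ONE continuation `L₀` of the
# mod-`p^{n+1}` twisted series (`Lᵢ = Pᵢ · L₀`, removed Euler factors explicit), and the transcendental `L₀(1)/Ω⁺_f` cancelled
# (seat `bsd-cm-prr-ty1` g14, cell `bsd-cm`; theorems only: no definition, no named fact, no instance, no `sorry`)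

Part 46 of the seat's kernel cut of stub 3 (cruxes stmt-BirchSwinnertonDyer-19945 / -19223).  Part 45 (E32
`KatoDescentKatoRigidTwistedValues`) substituted the value laws (C5) of both `ZetaBody` families into the level identity of a
collinear pair; the two families deplete the twisted series at DIFFERENT moduli `p·A₁`, `p·A₂` (`IsDepletedTwistedL f m (p·Aᵢ) χ Lᵢ`:
`Lᵢ` continues `Σ_{(k, m·p·Aᵢ)=1} a_k χ(k) k^{-s}`).  By the tree's Euler-factor calculus
(`twistedLSeries_changeLevel_eq_prod_mul`, `differentiable_eulerFactors` of `KatoTwistedFinitenessEulerFactorsProofs`, Kato §6.2)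
both are multiples of ANY entire continuation `L₀` of the mod-`m` series (`m = p^{n+1}`; one exists,
`exists_differentiable_eq_twistedLSeries_holds`): `Pᵢ · L₀` IS a `p·Aᵢ`-depleted continuation, with
`Pᵢ(s) = ∏_{ℓ ∣ m·p·Aᵢ, ℓ ∤ m} (1 − χ(ℓ)a_ℓ ℓ^{-s} + 𝟙_N(ℓ)χ(ℓ)² ℓ·ℓ^{-2s})` (the primes `ℓ ∣ Aᵢ`, `ℓ ≠ p`).
* §1 `isDepletedTwistedL_eulerFactors_mul` — `Pᵢ · L₀` is a depleted continuation (no identity theorem needed: E32 accepts ANY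
  depleted continuation);
* §2 `aeval_mul_depletedValues_eq_of_smul_eq_smul` — E32 with `Lᵢ := Pᵢ · L₀`:
  `r_F(u − 1)·(e • (1 ⊗ κ₁·(P₁(1)L₀(1)/Ω⁺_f)·𝒸⁻_χ̄(π₁))) = r_G(u − 1)·(1 ⊗ χ⁻¹(a)·(κ₂·(P₂(1)L₀(1)/Ω⁺_f)·𝒸⁻_χ̄(π₂)))` in `ℚ_p ⊗_ℚ ℂ`;
* §3 ★ `aeval_mul_explicitValues_eq_of_smul_eq_smul` — where `L₀(1) ≠ 0` (Rohrlich: all but finitely many `χ`,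
  `PSRohrlichAtLevel`) and `Ω⁺_f ≠ 0`, the common transcendental `L₀(1)/Ω⁺_f` cancels (`1 ⊗ t` is a unit):
  **`r_F(u − 1)·(e • (1 ⊗ κ₁·P₁(χ,1)·𝒸⁻_χ̄(π₁))) = r_G(u − 1)·(1 ⊗ χ⁻¹(a)·(κ₂·P₂(χ,1)·𝒸⁻_χ̄(π₂)))`** — at every such even character
  `χ` of `Gal(ℚ_n/ℚ)` the comparison of the two families is an identity between the unit `e`, the `ℤ_p`-polynomials `r_F, r_G` at
  `χ̄(γ) − 1` and EXPLICIT numbers of `ℚ(χ)` (`qᵢ`, `Pᵢ(χ,1)`, `𝒸⁻_χ̄(πᵢ)`, `χ̄(a)`).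
NEXT (successor; HOME `STUB3-CUT.md` §6 add. 6): the cusp/Euler factors as Iwasawa functions (Literature DEFINITIONS),
coherence of `a = a_m` across levels, Weierstrass preparation ⇒ AUG.
HONEST LABEL: theorems about the tree's readings; AUG displayed; no stub closed; nothing asserted on 19945 / 19223; Kato's Main
Conjecture / Perrin-Riou untouched; BSD is not proved for any curve.
References: [Kato2004Asterisque] §6.2 (p. 161), Thm. 6.6 (1) (p. 163), Thm. 9.7 (p. 189), §13.9 (p. 230); [Shimura1971] Thm. 3.66;
[DiamondShurman2005] Prop. 5.8.5.
-/

noncomputable section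

open scoped BigOperators NumberField TensorProduct
open Polynomial Field IsDedekindDomain CongruenceSubgroup
open Literature.NumberTheory.GaloisRepresentations
open Literature.NumberTheory.EllipticCurves Literature.NumberTheory.EllipticCurves.ModularForms
open Literature.NumberTheory.EllipticCurves.Kato2004 Literature.NumberTheory.EllipticCurves.Kato2004.EulerSystemValues
open Rat.HeightOneSpectrum
open Summit.BirchSwinnertonDyer.Rank1Residual.GaloisImage

namespace Summit.BirchSwinnertonDyer.Rank1Residual.Additive.PerrinRiouUnit

/-! ## §1 A depleted continuation from a mod-`m` continuation -/

section Depletion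

variable {N : ℕ} [NeZero N] {f : CuspForm (Gamma0 N) 2} {m : ℕ} [NeZero m] {M : ℕ} [NeZero M]

/-- **`P · L₀` is an `M`-depleted continuation** of the mod-`m` twisted series of `χ`, for every entire continuation `L₀` of
`Σ a_k χ(k) k^{-s}` and `P(s) = ∏_{ℓ ∣ mM, ℓ ∤ m}(1 − χ(ℓ)a_ℓ ℓ^{-s} + 𝟙_N(ℓ)χ(ℓ)²ℓ^{1-2s})` (`f` a newform, Hecke's relations).
[cite: Kato2004Asterisque, §6.2 (p. 161)] [cite: Shimura1971, Thm. 3.66] -/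
theorem isDepletedTwistedL_eulerFactors_mul (hf : IsNewform0 f) (χ : DirichletCharacter ℂ m) {L₀ : ℂ → ℂ}
    (hd : Differentiable ℂ L₀) (hs : ∀ s : ℂ, 2 < s.re → L₀ s = twistedLSeries f χ s) :
    IsDepletedTwistedL f m M χ (fun s => (∏ ℓ ∈ (m * M).primeFactors.filter (fun ℓ => ¬ ℓ ∣ m),
      (1 - χ (ℓ : ZMod m) * cuspCoeff f ℓ * (ℓ : ℂ) ^ (-s) +
        (if ℓ ∣ N then 0 else (ℓ : ℂ)) * χ (ℓ : ZMod m) ^ 2 * ((ℓ : ℂ) ^ (-s)) ^ 2)) * L₀ s) := by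
  haveI : NeZero (m * M) := ⟨mul_ne_zero (NeZero.ne m) (NeZero.ne M)⟩
  refine ⟨(differentiable_eulerFactors f χ fun ℓ hℓ =>
    Nat.prime_of_mem_primeFactors (Finset.mem_filter.mp hℓ).1).mul hd, fun s hs2 => ?_⟩
  simp only
  rw [hs s hs2, twistedLSeries_changeLevel_eq_prod_mul hf (dvd_mul_right m M) χ hs2]

end Depletion

/-! ## §2 The level identity with one continuation and explicit Euler factors -/

section Values

variable {W : WeierstrassCurve ℚ} [W.IsElliptic] {p : ℕ} [Fact p.Prime] [ContinuousSMul ℤ_[p] (W.tateModule p)]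
  [Module.Free ℤ_[p] (W.tateModule p)] [Module.Finite ℤ_[p] (W.tateModule p)]
  {N : ℕ} [NeZero N] {f : CuspForm (Gamma0 N) 2} {ι₁ ι₂ : (m : ℕ) → (CyclotomicField m ℚ →+* ℂ)} {κ₁ κ₂ : ℝ}
  {Λ₁ Λ₂ : ∀ (k : ℕ) (r : Finset (HeightOneSpectrum (𝓞 ℚ))),
    H1 (tateRep W p) (cycSubgroup p k r) →ₗ[ℤ_[p]] ℚ_[p] ⊗[ℚ] CyclotomicField (cycLevel p k r) ℚ}
  {c₁ d₁ a₁ : ℤ} {A₁ : ℕ} {c₂ d₂ a₂ : ℤ} {A₂ : ℕ}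
  {z₁ : ∀ (k : ℕ) (r : (cyclotomicLevelsRat p (badPlaces c₁ d₁ A₁ N)).Ideals),
    H1 (tateRep W p) ((cyclotomicLevelsRat p (badPlaces c₁ d₁ A₁ N)).level k r.1)}
  {x₁ : ∀ (k : ℕ) (r : (cyclotomicLevelsRat p (badPlaces c₁ d₁ A₁ N)).Ideals), CyclotomicField (cycLevel p k r.1) ℚ}
  {z₂ : ∀ (k : ℕ) (r : (cyclotomicLevelsRat p (badPlaces c₂ d₂ A₂ N)).Ideals),
    H1 (tateRep W p) ((cyclotomicLevelsRat p (badPlaces c₂ d₂ A₂ N)).level k r.1)}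
  {x₂ : ∀ (k : ℕ) (r : (cyclotomicLevelsRat p (badPlaces c₂ d₂ A₂ N)).Ideals), CyclotomicField (cycLevel p k r.1) ℚ}
  {K : ZpExtension ℚ p} {γ : absoluteGaloisGroup ℚ}

/-- **The level identity of a collinear pair with ONE continuation `L₀` of the mod-`p^{n+1}` series and the removed Euler
factors explicit.**  E32 `aeval_mul_values_eq_of_smul_eq_smul` fed with the depleted continuations `Pᵢ · L₀` of §1
(`f` a newform, `Aᵢ ≠ 0`):
`r_F(u − 1)·(e • (1 ⊗ κ₁·(P₁(1)L₀(1)/Ω⁺_f)·𝒸⁻_χ̄(π₁))) = r_G(u − 1)·(1 ⊗ χ⁻¹(a)·(κ₂·(P₂(1)L₀(1)/Ω⁺_f)·𝒸⁻_χ̄(π₂)))` in `ℚ_p ⊗_ℚ ℂ`,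
`Pᵢ(1) = ∏_{ℓ ∣ p^{n+1}·p·Aᵢ, ℓ ∤ p^{n+1}} (1 − χ(ℓ)a_ℓ/ℓ + 𝟙_N(ℓ)χ(ℓ)²/ℓ)`.
[cite: Kato2004Asterisque, §6.2 (p. 161), Thm. 6.6 (1) (p. 163), Thm. 9.7 (p. 189), §13.9 (p. 230)] -/
theorem aeval_mul_depletedValues_eq_of_smul_eq_smul (hb₁ : ZetaBody W p f ι₁ κ₁ Λ₁ c₁ d₁ a₁ A₁ z₁ x₁)
    (hb₂ : ZetaBody W p f ι₂ κ₂ Λ₂ c₂ d₂ a₂ A₂ z₂ x₂) (hf : IsNewform0 f) (hA₁ : A₁ ≠ 0) (hA₂ : A₂ ≠ 0)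
    (hK : K.IsCyclotomic) (hp : p ≠ 2) (hγ : K.IsTopGenerator γ)
    (I : IwasawaH1Data W p K γ) (n : ℕ) {y₁ y₂ : I.H}
    (hy₁ : I.proj n y₁ = levelToLayer W p hK hp (badPlaces c₁ d₁ A₁ N) n
      (z₁ (n + 1) (cyclotomicLevelsRat p (badPlaces c₁ d₁ A₁ N)).idealOne))
    (hy₂ : I.proj n y₂ = levelToLayer W p hK hp (badPlaces c₂ d₂ A₂ N) n
      (z₂ (n + 1) (cyclotomicLevelsRat p (badPlaces c₂ d₂ A₂ N)).idealOne))
    {e : ℚ_[p]} (hΛ : ∀ y : H1 (tateRep W p) (cycSubgroup p (n + 1) ∅), Λ₂ (n + 1) ∅ y = e • Λ₁ (n + 1) ∅ y)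
    {F G : IwasawaAlgebra p} {rF rG : ℤ_[p][X]}
    (hF : F - (rF : PowerSeries ℤ_[p]) ∈
      Ideal.span {(((Polynomial.X + 1 : ℤ_[p][X]) ^ p ^ n - 1 : ℤ_[p][X]) : PowerSeries ℤ_[p])})
    (hG : G - (rG : PowerSeries ℤ_[p]) ∈
      Ideal.span {(((Polynomial.X + 1 : ℤ_[p][X]) ^ p ^ n - 1 : ℤ_[p][X]) : PowerSeries ℤ_[p])})
    (hFG : F • y₁ = G • y₂)
    (χ : DirichletCharacter ℂ (cycLevel p (n + 1) ∅))
    (hχ : ∀ σ ∈ K.layerSubgroup n,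
      χ ((modNCyclotomicCharacter ℚ (cycLevel p (n + 1) ∅) σ : (ZMod (cycLevel p (n + 1) ∅))ˣ) :
        ZMod (cycLevel p (n + 1) ∅)) = 1)
    (heven : χ (-1) = 1)
    {ev : ℚ_[p] ⊗[ℚ] CyclotomicField (cycLevel p (n + 1) ∅) ℚ →ₗ[ℚ_[p]] ℚ_[p] ⊗[ℚ] ℂ}
    (hev : ∀ (s : ℚ_[p]) (x : CyclotomicField (cycLevel p (n + 1) ∅) ℚ),
      ev (s ⊗ₜ[ℚ] x) = s ⊗ₜ[ℚ] charSum (cycLevel p (n + 1) ∅) (ι₁ (cycLevel p (n + 1) ∅)) χ x)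
    {a : (ZMod (cycLevel p (n + 1) ∅))ˣ}
    (ha : ∀ y, ι₂ (cycLevel p (n + 1) ∅) (sigma (cycLevel p (n + 1) ∅) a y) = ι₁ (cycLevel p (n + 1) ∅) y)
    (d'₁ d'₂ : ℤ) (hcd₁ : Int.gcd (c₁ * d₁) (cycLevel p (n + 1) ∅ * A₁) = 1) (hdd₁ : d₁ * d'₁ ≡ 1 [ZMOD (A₁ : ℤ)])
    (hcd₂ : Int.gcd (c₂ * d₂) (cycLevel p (n + 1) ∅ * A₂) = 1) (hdd₂ : d₂ * d'₂ ≡ 1 [ZMOD (A₂ : ℤ)])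
    {L₀ : ℂ → ℂ} (hd : Differentiable ℂ L₀)
    (hs : ∀ s : ℂ, 2 < s.re → L₀ s = twistedLSeries f χ s) :
    aeval (((1 : ℚ_[p]) ⊗ₜ[ℚ] χ⁻¹ ((modNCyclotomicCharacter ℚ (cycLevel p (n + 1) ∅) γ : (ZMod (cycLevel p (n + 1) ∅))ˣ) :
        ZMod (cycLevel p (n + 1) ∅)) : ℚ_[p] ⊗[ℚ] ℂ) - 1) rF *
        (e • ((1 : ℚ_[p]) ⊗ₜ[ℚ] ((κ₁ : ℂ) *
          ((∏ ℓ ∈ (cycLevel p (n + 1) ∅ * (p * A₁)).primeFactors.filter (fun ℓ => ¬ ℓ ∣ cycLevel p (n + 1) ∅),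
              (1 - χ (ℓ : ZMod (cycLevel p (n + 1) ∅)) * cuspCoeff f ℓ * (ℓ : ℂ) ^ (-(1 : ℂ)) +
                (if ℓ ∣ N then 0 else (ℓ : ℂ)) * χ (ℓ : ZMod (cycLevel p (n + 1) ∅)) ^ 2 * ((ℓ : ℂ) ^ (-(1 : ℂ))) ^ 2)) *
            L₀ 1 / (plusPeriod f : ℂ)) *
          cuspFactor f true (fun k ↦ χ⁻¹ (k : ZMod (cycLevel p (n + 1) ∅))) c₁ d₁ a₁ A₁ d'₁))) =
      aeval (((1 : ℚ_[p]) ⊗ₜ[ℚ] χ⁻¹ ((modNCyclotomicCharacter ℚ (cycLevel p (n + 1) ∅) γ : (ZMod (cycLevel p (n + 1) ∅))ˣ) :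
        ZMod (cycLevel p (n + 1) ∅)) : ℚ_[p] ⊗[ℚ] ℂ) - 1) rG *
        ((1 : ℚ_[p]) ⊗ₜ[ℚ] (χ⁻¹ (a : ZMod (cycLevel p (n + 1) ∅)) * ((κ₂ : ℂ) *
          ((∏ ℓ ∈ (cycLevel p (n + 1) ∅ * (p * A₂)).primeFactors.filter (fun ℓ => ¬ ℓ ∣ cycLevel p (n + 1) ∅),
              (1 - χ (ℓ : ZMod (cycLevel p (n + 1) ∅)) * cuspCoeff f ℓ * (ℓ : ℂ) ^ (-(1 : ℂ)) +
                (if ℓ ∣ N then 0 else (ℓ : ℂ)) * χ (ℓ : ZMod (cycLevel p (n + 1) ∅)) ^ 2 * ((ℓ : ℂ) ^ (-(1 : ℂ))) ^ 2)) *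
            L₀ 1 / (plusPeriod f : ℂ)) *
          cuspFactor f true (fun k ↦ χ⁻¹ (k : ZMod (cycLevel p (n + 1) ∅))) c₂ d₂ a₂ A₂ d'₂))) := by
  haveI : NeZero (p * A₁) := ⟨mul_ne_zero (Fact.out : p.Prime).ne_zero hA₁⟩
  haveI : NeZero (p * A₂) := ⟨mul_ne_zero (Fact.out : p.Prime).ne_zero hA₂⟩
  have h := aeval_mul_values_eq_of_smul_eq_smul hb₁ hb₂ hK hp hγ I n hy₁ hy₂ hΛ hF hG hFG χ hχ heven hev ha d'₁ d'₂ hcd₁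
    hdd₁ hcd₂ hdd₂ (isDepletedTwistedL_eulerFactors_mul (M := p * A₁) hf χ hd hs)
    (isDepletedTwistedL_eulerFactors_mul (M := p * A₂) hf χ hd hs)
  beta_reduce at h
  exact h


/-! ## §3 Cancelling the common transcendental `L₀(1)/Ω⁺_f` -/

/-- `1 ⊗ (X·t) = (1 ⊗ X)·(1 ⊗ t)` in `ℚ_p ⊗_ℚ ℂ`. [folklore] -/
theorem one_tmul_mul (X t : ℂ) :
    ((1 : ℚ_[p]) ⊗ₜ[ℚ] (X * t) : ℚ_[p] ⊗[ℚ] ℂ) = ((1 : ℚ_[p]) ⊗ₜ[ℚ] X) * ((1 : ℚ_[p]) ⊗ₜ[ℚ] t) := by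
  rw [Algebra.TensorProduct.tmul_mul_tmul, one_mul]

/-- **The level identity between EXPLICIT cyclotomic numbers.**  Where the common continuation does not vanish at `1`
(`L₀(1) ≠ 0`; Rohrlich: all but finitely many `χ`) and `Ω⁺_f ≠ 0`, the transcendental `L₀(1)/Ω⁺_f` cancels from §2
(`1 ⊗ t` is a unit of `ℚ_p ⊗_ℚ ℂ` for `t ≠ 0`):
`r_F(u − 1)·(e • (1 ⊗ κ₁·P₁(χ,1)·𝒸⁻_χ̄(π₁))) = r_G(u − 1)·(1 ⊗ χ⁻¹(a)·(κ₂·P₂(χ,1)·𝒸⁻_χ̄(π₂)))` in `ℚ_p ⊗_ℚ ℂ` — an identity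
between the unit `e`, the `ℤ_p`-polynomials `r_F, r_G` at `χ̄(γ) − 1` and numbers of the cyclotomic field `ℚ(χ)`.
[cite: Kato2004Asterisque, §13.9 (p. 230), Thm. 6.6 (1) (p. 163), Thm. 9.7 (p. 189), §6.2 (p. 161)] -/
theorem aeval_mul_explicitValues_eq_of_smul_eq_smul (hb₁ : ZetaBody W p f ι₁ κ₁ Λ₁ c₁ d₁ a₁ A₁ z₁ x₁)
    (hb₂ : ZetaBody W p f ι₂ κ₂ Λ₂ c₂ d₂ a₂ A₂ z₂ x₂) (hf : IsNewform0 f) (hA₁ : A₁ ≠ 0) (hA₂ : A₂ ≠ 0)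
    (hK : K.IsCyclotomic) (hp : p ≠ 2) (hγ : K.IsTopGenerator γ)
    (I : IwasawaH1Data W p K γ) (n : ℕ) {y₁ y₂ : I.H}
    (hy₁ : I.proj n y₁ = levelToLayer W p hK hp (badPlaces c₁ d₁ A₁ N) n
      (z₁ (n + 1) (cyclotomicLevelsRat p (badPlaces c₁ d₁ A₁ N)).idealOne))
    (hy₂ : I.proj n y₂ = levelToLayer W p hK hp (badPlaces c₂ d₂ A₂ N) n
      (z₂ (n + 1) (cyclotomicLevelsRat p (badPlaces c₂ d₂ A₂ N)).idealOne))
    {e : ℚ_[p]} (hΛ : ∀ y : H1 (tateRep W p) (cycSubgroup p (n + 1) ∅), Λ₂ (n + 1) ∅ y = e • Λ₁ (n + 1) ∅ y)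
    {F G : IwasawaAlgebra p} {rF rG : ℤ_[p][X]}
    (hF : F - (rF : PowerSeries ℤ_[p]) ∈
      Ideal.span {(((Polynomial.X + 1 : ℤ_[p][X]) ^ p ^ n - 1 : ℤ_[p][X]) : PowerSeries ℤ_[p])})
    (hG : G - (rG : PowerSeries ℤ_[p]) ∈
      Ideal.span {(((Polynomial.X + 1 : ℤ_[p][X]) ^ p ^ n - 1 : ℤ_[p][X]) : PowerSeries ℤ_[p])})
    (hFG : F • y₁ = G • y₂)
    (χ : DirichletCharacter ℂ (cycLevel p (n + 1) ∅))
    (hχ : ∀ σ ∈ K.layerSubgroup n,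
      χ ((modNCyclotomicCharacter ℚ (cycLevel p (n + 1) ∅) σ : (ZMod (cycLevel p (n + 1) ∅))ˣ) :
        ZMod (cycLevel p (n + 1) ∅)) = 1)
    (heven : χ (-1) = 1)
    {ev : ℚ_[p] ⊗[ℚ] CyclotomicField (cycLevel p (n + 1) ∅) ℚ →ₗ[ℚ_[p]] ℚ_[p] ⊗[ℚ] ℂ}
    (hev : ∀ (s : ℚ_[p]) (x : CyclotomicField (cycLevel p (n + 1) ∅) ℚ),
      ev (s ⊗ₜ[ℚ] x) = s ⊗ₜ[ℚ] charSum (cycLevel p (n + 1) ∅) (ι₁ (cycLevel p (n + 1) ∅)) χ x)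
    {a : (ZMod (cycLevel p (n + 1) ∅))ˣ}
    (ha : ∀ y, ι₂ (cycLevel p (n + 1) ∅) (sigma (cycLevel p (n + 1) ∅) a y) = ι₁ (cycLevel p (n + 1) ∅) y)
    (d'₁ d'₂ : ℤ) (hcd₁ : Int.gcd (c₁ * d₁) (cycLevel p (n + 1) ∅ * A₁) = 1) (hdd₁ : d₁ * d'₁ ≡ 1 [ZMOD (A₁ : ℤ)])
    (hcd₂ : Int.gcd (c₂ * d₂) (cycLevel p (n + 1) ∅ * A₂) = 1) (hdd₂ : d₂ * d'₂ ≡ 1 [ZMOD (A₂ : ℤ)])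
    {L₀ : ℂ → ℂ} (hd : Differentiable ℂ L₀)
    (hs : ∀ s : ℂ, 2 < s.re → L₀ s = twistedLSeries f χ s)
    (hL : L₀ 1 ≠ 0) (hΩ : plusPeriod f ≠ 0) :
    aeval (((1 : ℚ_[p]) ⊗ₜ[ℚ] χ⁻¹ ((modNCyclotomicCharacter ℚ (cycLevel p (n + 1) ∅) γ : (ZMod (cycLevel p (n + 1) ∅))ˣ) :
        ZMod (cycLevel p (n + 1) ∅)) : ℚ_[p] ⊗[ℚ] ℂ) - 1) rF *
        (e • ((1 : ℚ_[p]) ⊗ₜ[ℚ] ((κ₁ : ℂ) *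
          (∏ ℓ ∈ (cycLevel p (n + 1) ∅ * (p * A₁)).primeFactors.filter (fun ℓ => ¬ ℓ ∣ cycLevel p (n + 1) ∅),
              (1 - χ (ℓ : ZMod (cycLevel p (n + 1) ∅)) * cuspCoeff f ℓ * (ℓ : ℂ) ^ (-(1 : ℂ)) +
                (if ℓ ∣ N then 0 else (ℓ : ℂ)) * χ (ℓ : ZMod (cycLevel p (n + 1) ∅)) ^ 2 * ((ℓ : ℂ) ^ (-(1 : ℂ))) ^ 2)) *
          cuspFactor f true (fun k ↦ χ⁻¹ (k : ZMod (cycLevel p (n + 1) ∅))) c₁ d₁ a₁ A₁ d'₁))) =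
      aeval (((1 : ℚ_[p]) ⊗ₜ[ℚ] χ⁻¹ ((modNCyclotomicCharacter ℚ (cycLevel p (n + 1) ∅) γ : (ZMod (cycLevel p (n + 1) ∅))ˣ) :
        ZMod (cycLevel p (n + 1) ∅)) : ℚ_[p] ⊗[ℚ] ℂ) - 1) rG *
        ((1 : ℚ_[p]) ⊗ₜ[ℚ] (χ⁻¹ (a : ZMod (cycLevel p (n + 1) ∅)) * ((κ₂ : ℂ) *
          (∏ ℓ ∈ (cycLevel p (n + 1) ∅ * (p * A₂)).primeFactors.filter (fun ℓ => ¬ ℓ ∣ cycLevel p (n + 1) ∅),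
              (1 - χ (ℓ : ZMod (cycLevel p (n + 1) ∅)) * cuspCoeff f ℓ * (ℓ : ℂ) ^ (-(1 : ℂ)) +
                (if ℓ ∣ N then 0 else (ℓ : ℂ)) * χ (ℓ : ZMod (cycLevel p (n + 1) ∅)) ^ 2 * ((ℓ : ℂ) ^ (-(1 : ℂ))) ^ 2)) *
          cuspFactor f true (fun k ↦ χ⁻¹ (k : ZMod (cycLevel p (n + 1) ∅))) c₂ d₂ a₂ A₂ d'₂))) := by
  have h := aeval_mul_depletedValues_eq_of_smul_eq_smul hb₁ hb₂ hf hA₁ hA₂ hK hp hγ I n hy₁ hy₂ hΛ hF hG hFG χ hχ heven hev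
    ha d'₁ d'₂ hcd₁ hdd₁ hcd₂ hdd₂ hd hs
  generalize (∏ ℓ ∈ (cycLevel p (n + 1) ∅ * (p * A₁)).primeFactors.filter (fun ℓ => ¬ ℓ ∣ cycLevel p (n + 1) ∅),
              (1 - χ (ℓ : ZMod (cycLevel p (n + 1) ∅)) * cuspCoeff f ℓ * (ℓ : ℂ) ^ (-(1 : ℂ)) +
                (if ℓ ∣ N then 0 else (ℓ : ℂ)) * χ (ℓ : ZMod (cycLevel p (n + 1) ∅)) ^ 2 * ((ℓ : ℂ) ^ (-(1 : ℂ))) ^ 2)) = P₁ at h ⊢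
  generalize (∏ ℓ ∈ (cycLevel p (n + 1) ∅ * (p * A₂)).primeFactors.filter (fun ℓ => ¬ ℓ ∣ cycLevel p (n + 1) ∅),
              (1 - χ (ℓ : ZMod (cycLevel p (n + 1) ∅)) * cuspCoeff f ℓ * (ℓ : ℂ) ^ (-(1 : ℂ)) +
                (if ℓ ∣ N then 0 else (ℓ : ℂ)) * χ (ℓ : ZMod (cycLevel p (n + 1) ∅)) ^ 2 * ((ℓ : ℂ) ^ (-(1 : ℂ))) ^ 2)) = P₂ at h ⊢
  generalize cuspFactor f true (fun k ↦ χ⁻¹ (k : ZMod (cycLevel p (n + 1) ∅))) c₁ d₁ a₁ A₁ d'₁ = C₁ at h ⊢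
  generalize cuspFactor f true (fun k ↦ χ⁻¹ (k : ZMod (cycLevel p (n + 1) ∅))) c₂ d₂ a₂ A₂ d'₂ = C₂ at h ⊢
  have hΩ' : (plusPeriod f : ℂ) ≠ 0 := Complex.ofReal_ne_zero.mpr hΩ
  have htu : IsUnit ((1 : ℚ_[p]) ⊗ₜ[ℚ] (L₀ 1 / (plusPeriod f : ℂ)) : ℚ_[p] ⊗[ℚ] ℂ) :=
    (IsUnit.mk0 _ (div_ne_zero hL hΩ')).map (Algebra.TensorProduct.includeRight : ℂ →ₐ[ℚ] ℚ_[p] ⊗[ℚ] ℂ)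
  have e1 : (κ₁ : ℂ) * (P₁ * L₀ 1 / (plusPeriod f : ℂ)) * C₁ = (κ₁ : ℂ) * P₁ * C₁ * (L₀ 1 / (plusPeriod f : ℂ)) := by
    ring
  have e2 : χ⁻¹ (a : ZMod (cycLevel p (n + 1) ∅)) * ((κ₂ : ℂ) * (P₂ * L₀ 1 / (plusPeriod f : ℂ)) * C₂) =
      χ⁻¹ (a : ZMod (cycLevel p (n + 1) ∅)) * ((κ₂ : ℂ) * P₂ * C₂) * (L₀ 1 / (plusPeriod f : ℂ)) := by
    ring
  rw [e1, e2, one_tmul_mul ((κ₁ : ℂ) * P₁ * C₁), one_tmul_mul (χ⁻¹ (a : ZMod (cycLevel p (n + 1) ∅)) * ((κ₂ : ℂ) * P₂ * C₂)),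
    ← smul_mul_assoc, ← mul_assoc, ← mul_assoc] at h
  exact (IsUnit.mul_left_inj htu).mp h

end Values

end Summit.BirchSwinnertonDyer.Rank1Residual.Additive.PerrinRiouUnit

end
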